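/-
Copyright (c) 2026. All rights reserved.
Released under Apache 2.0 license as described in the file LICENSE.
Authors: abc-iut cell, prover seat abc-iut-f-028 (F fact-proving wave, tranche 28), over the statements of abc-iut-L1-t4.
-/
import Literature.AlgebraicGeometry.Frobenioids.CircleOpensProofs2
import Literature.AlgebraicGeometry.Frobenioids.CircleOpensProofs5
import HarnessLib

/-!
# Frobenioids II, Lemma 3.2 (vi): conditions (a), (b) — their exact range (kernel census of `CondA`, `CondB`)

S. Mochizuki, *The geometry of Frobenioids II: poly-Frobenioids*, Kyushu J. Math. **62** (2008)
401–460 [MochizukiFrdII2008], §3, Lemma 3.2 (vi), author's text pp. 25–26: for [nonempty] connected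
open `A ⊆ B ⊆ S¹` with `A ≠ B`, "consider the following conditions: (a) for any two `(A, B)`-subsets
`A₁, A₂`, either `A₁ ⊆ A₂` or `A₂ ⊆ A₁`; (b) for any two distinct `(A, B)`-subsets `A₁ ⊆ A₂`, there
exists an `(A₁, A₂)`-subset `A₃` such that `A₃ ≠ A₁, A₂`; … Then (a) holds if and only if both (c)
and (d) hold; both (a) and (b) hold if and only if both (c) and (e) hold" (FACT-LIST rows F-0984
`CondA`, F-0985 `CondB`; row F-0997 `ItemVI` is the biconditional, PROVED as `ItemVI_holds`).

Proof-only companion (theorems only, no new notions) of `CircleOpens.lean` (abc-iut-L1-t4), where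
(a) and (b) are the two-place predicates `CircleOpens.CondA A B`, `CircleOpens.CondB A B`.  They are
CONDITIONS — hypothesis vocabulary of the definition "continuously ordered" — not facts: this file
records in the kernel

* that their universal closures are FALSE, even under the standing hypotheses `Setting A B`,
  `A ≠ B` of Lemma 3.2 (vi) (`not_forall_condA`, `not_forall_setting_condA`, `not_forall_condB`,
  `not_forall_setting_condB`), at the explicit witnesses `exp(i·(1,2)) ⊊ exp(i·(0,3))` (two
  incomparable intermediate arcs, `not_condA_middle_arc`), `exp(i·(0,1)) ⊊ S¹` (`not_condA_arc_univ`)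
  and `S¹ ∖ {p} ⊊ S¹` (no intermediate subset, `not_condB_compl_singleton_univ`);
* their exact range under the standing hypotheses, BY NAME from the tree's Lemma 3.2 (vi):
  `condA_iff_condC_and_condD` (= `(ItemVI_holds …).1`, the printed "(a) ⟺ (c) ∧ (d)"),
  `condA_univ_iff` (for `B = S¹`: (a) ⟺ `S¹ ∖ A` has at most one point), and for (b) the sharper
  reading implicit in the printed proof — `condB_iff_ne_univ`: for `A ≠ B`, (b) ⟺ `B ≠ S¹` ⟺ (e)
  (`condB_of_ne_univ` from `condB_of_arc`; `not_condB_univ`: between `S¹ ∖ {p} ⊇ A` and `S¹` there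
  is no third connected open set);
* the degenerate instances `condA_of_eq`, `condB_of_eq` (`A = B`: both hold).

The instance forms the cone consumes are the tree's `condA_arc_iff`, `condB_of_arc`
(`CircleOpensSubarcs.lean`) and `ItemVI_holds`; nothing of `CircleOpens.lean` is restated or edited.
no side taken on [IUTchIII] Cor 3.12; typed ≠ proved; a condition is an assumption label by name.
-/

namespace Literature.AlgebraicGeometry.Frobenioids

open Set Function Topology Real
open scoped Pointwise

namespace CircleOpens

/-! ### The degenerate pair `A = B` -/

/-- For `A = B` every `(A, B)`-subset equals `A`, so condition (a) holds.
[cite: MochizukiFrdII2008, Lem 3.2 (vi)(a) p.25] -/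
theorem condA_of_eq {A B : Set Circle} (h : A = B) : CondA A B := by
  subst h
  intro A₁ A₂ h₁ h₂
  rw [le_antisymm h₁.2.2.2 h₁.2.2.1, le_antisymm h₂.2.2.2 h₂.2.2.1]
  exact Or.inl subset_rfl

/-- For `A = B` there are no two distinct `(A, B)`-subsets, so condition (b) holds (vacuously).
[cite: MochizukiFrdII2008, Lem 3.2 (vi)(b) p.26] -/
theorem condB_of_eq {A B : Set Circle} (h : A = B) : CondB A B := by
  subst h
  intro A₁ A₂ h₁ h₂ _ hne
  exact absurd ((le_antisymm h₁.2.2.2 h₁.2.2.1).trans (le_antisymm h₂.2.2.2 h₂.2.2.1).symm) hne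

/-! ### Condition (a): exact range -/

/-- **Lemma 3.2 (vi), first equivalence** (FrdII p. 26), by name: for `A ≠ B`, "(a) holds if and only
if both (c) and (d) hold". [cite: MochizukiFrdII2008, Lem 3.2 (vi) p.26] -/
theorem condA_iff_condC_and_condD {A B : Set Circle} (h : Setting A B) (hne : A ≠ B) :
    CondA A B ↔ CondC A B ∧ CondD A B :=
  (ItemVI_holds A B h hne).1

/-- Condition (a) for `B = S¹`: the `(A, S¹)`-subsets are pairwise comparable iff `S¹ ∖ A` has at most
one point (two points `p ≠ q` of the complement give the incomparable `S¹ ∖ {p}`, `S¹ ∖ {q}`).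
[cite: MochizukiFrdII2008, Lem 3.2 (vi) p.26] -/
theorem condA_univ_iff {A : Set Circle} (hA : IsConnected A) (hAo : IsOpen A) (hne : A ≠ univ) :
    CondA A univ ↔ (univ \ A).Subsingleton := by
  have h6 := (ItemVI_holds A univ (setting_univ hA hAo) hne).1
  constructor
  · intro hAc
    exact (h6.mp hAc).2 rfl
  · intro hs
    exact h6.mpr ⟨hs.isPreconnected, fun _ => hs⟩

/-- **Condition (a) fails** for the pair `exp(i·(1, 2)) ⊊ exp(i·(0, 3))`: the `(A, B)`-subsets
`exp(i·(0, 2))`, `exp(i·(1, 3))` are incomparable (`condA_arc_iff`: no shared endpoint).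
[cite: MochizukiFrdII2008, Lem 3.2 (vi)(a) p.25] -/
theorem not_condA_middle_arc : ¬ CondA (Circle.exp '' Ioo 1 2) (Circle.exp '' Ioo 0 3) := by
  rw [condA_arc_iff (c := 0) (d := 3) (a := 1) (b := 2) (by linarith [two_le_pi]) (by norm_num)
    (by norm_num) (by norm_num)]
  norm_num

/-- **Condition (a) fails** for the pair `exp(i·(0, 1)) ⊊ S¹`: the complement contains the two points
`exp(2i) ≠ exp(3i)`. [cite: MochizukiFrdII2008, Lem 3.2 (vi)(a) p.25] -/
theorem not_condA_arc_univ : ¬ CondA (Circle.exp '' Ioo 0 1) univ := by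
  have hne : Circle.exp '' Ioo (0 : ℝ) 1 ≠ univ := by
    intro h
    have := exp_left_notMem_exp_image_Ioo (c := (0 : ℝ)) (d := 1) (by linarith [two_le_pi])
    rw [h] at this
    exact this trivial
  rw [condA_univ_iff (isConnected_exp_image_Ioo (by norm_num)) (isOpen_exp_image isOpen_Ioo) hne,
    univ_diff_arc (by norm_num) (by linarith [two_le_pi])]
  intro hs
  have h2 : Circle.exp 2 ∈ Circle.exp '' Icc (1 : ℝ) (0 + 2 * π) :=
    ⟨2, ⟨by norm_num, by linarith [two_le_pi]⟩, rfl⟩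
  have h3 : Circle.exp 3 ∈ Circle.exp '' Icc (1 : ℝ) (0 + 2 * π) :=
    ⟨3, ⟨by norm_num, by linarith [two_le_pi]⟩, rfl⟩
  have h23 : (2 : ℝ) = 3 :=
    Circle.exp_injOn_Icc (a := 2) (b := 3) (by linarith [two_le_pi])
      ⟨le_rfl, by norm_num⟩ ⟨by norm_num, le_rfl⟩ (hs h2 h3)
  norm_num at h23

/-- The universal closure of condition (a) is false. [cite: MochizukiFrdII2008, Lem 3.2 (vi)(a) p.25] -/
theorem not_forall_condA : ¬ ∀ A B : Set Circle, CondA A B :=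
  fun h => not_condA_arc_univ (h _ _)

/-- The universal closure of condition (a) is false even under the standing hypotheses of
Lemma 3.2 (vi) ([nonempty] connected open `A ⊊ B`). [cite: MochizukiFrdII2008, Lem 3.2 (vi)(a) p.25] -/
theorem not_forall_setting_condA : ¬ ∀ A B : Set Circle, Setting A B → A ≠ B → CondA A B := by
  intro h
  refine not_condA_middle_arc (h _ _ ⟨isConnected_exp_image_Ioo (by norm_num),
    isOpen_exp_image isOpen_Ioo, isConnected_exp_image_Ioo (by norm_num), isOpen_exp_image isOpen_Ioo,
    image_mono (Ioo_subset_Ioo (by norm_num) (by norm_num))⟩ ?_)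
  intro heq
  have := (exp_image_Ioo_eq_iff (c := 0) (a₁ := 1) (b₁ := 2) (a₂ := 0) (b₂ := 3) (by norm_num)
    (by norm_num) (by norm_num) (by linarith [two_le_pi]) le_rfl (by linarith [two_le_pi])).mp heq
  norm_num at this

/-! ### Condition (b): exact range -/

/-- A set containing `S¹ ∖ {p}` is `S¹ ∖ {p}` or `S¹`. [cite: MochizukiFrdII2008, Lem 3.2 (vi)(b) p.26] -/
theorem eq_or_eq_univ_of_compl_singleton_subset {p : Circle} {C : Set Circle} (h : {p}ᶜ ⊆ C) :
    C = {p}ᶜ ∨ C = univ := by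
  by_cases hp : p ∈ C
  · refine Or.inr (eq_univ_of_forall fun x => ?_)
    by_cases hx : x = p
    · exact hx ▸ hp
    · exact h hx
  · refine Or.inl (le_antisymm (fun x hx hxp => hp ?_) h)
    rw [mem_singleton_iff.mp hxp] at hx
    exact hx

/-- **Condition (b) fails** for `S¹ ∖ {p} ⊊ S¹`: there is no connected open set strictly between them.
[cite: MochizukiFrdII2008, Lem 3.2 (vi)(b) p.26] -/
theorem not_condB_compl_singleton_univ (p : Circle) : ¬ CondB {p}ᶜ univ := by
  intro hB
  have hp : p ∉ ({p}ᶜ : Set Circle) := fun h => h rfl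
  obtain ⟨A₃, h₃, h₃₁, h₃₂⟩ := hB {p}ᶜ univ (isSub_compl_singleton hp)
    ⟨isConnected_univ, isOpen_univ, subset_univ _, subset_rfl⟩ (subset_univ _)
    (ne_univ_iff_exists_notMem _ |>.mpr ⟨p, hp⟩)
  rcases eq_or_eq_univ_of_compl_singleton_subset h₃.2.2.1 with e | e
  · exact h₃₁ e
  · exact h₃₂ e

/-- **Condition (b) fails whenever `B = S¹`** (and `A ≠ S¹`): with `p ∉ A`, the `(A, S¹)`-subsets
`S¹ ∖ {p} ⊊ S¹` admit no intermediate `(S¹ ∖ {p}, S¹)`-subset — the content of "(a) ∧ (b) ⟹ (e)" in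
the printed proof. [cite: MochizukiFrdII2008, Lem 3.2 (vi) p.26] -/
theorem not_condB_univ {A : Set Circle} (hne : A ≠ univ) : ¬ CondB A univ := by
  intro hB
  obtain ⟨p, hp⟩ := (ne_univ_iff_exists_notMem A).mp hne
  have hp' : p ∉ ({p}ᶜ : Set Circle) := fun h => h rfl
  obtain ⟨A₃, h₃, h₃₁, h₃₂⟩ := hB {p}ᶜ univ (isSub_compl_singleton hp)
    ⟨isConnected_univ, isOpen_univ, subset_univ A, subset_rfl⟩ (subset_univ _)
    (ne_univ_iff_exists_notMem _ |>.mpr ⟨p, hp'⟩)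
  rcases eq_or_eq_univ_of_compl_singleton_subset h₃.2.2.1 with e | e
  · exact h₃₁ e
  · exact h₃₂ e

/-- **Condition (b) holds whenever `B ≠ S¹`**: `B` is a proper arc `exp(i·(c, d))`, `A ⊆ B` a sub-arc,
and between two distinct nested sub-arcs lies the arc with averaged endpoints (`condB_of_arc`).
[cite: MochizukiFrdII2008, Lem 3.2 (vi)(b) p.26] -/
theorem condB_of_ne_univ {A B : Set Circle} (h : Setting A B) (hB : B ≠ univ) : CondB A B := by
  obtain ⟨c, d, hcd, hlen, rfl⟩ := exists_eq_exp_image_Ioo h.isConnected_right h.isOpen_right hB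
  have hcA : Circle.exp c ∉ A := fun hA => exp_left_notMem_exp_image_Ioo hlen (h.subset hA)
  obtain ⟨a, b, hca, hab, hb2, rfl⟩ :=
    exists_eq_exp_image_Ioo_of_notMem h.isConnected_left h.isOpen_left hcA
  have hbd : b ≤ d :=
    ((exp_image_Ioo_subset_iff hab hca hb2 le_rfl (by linarith)).mp h.subset).2
  exact condB_of_arc hlen hca hab hbd

/-- **Exact range of condition (b)** under the standing hypotheses of Lemma 3.2 (vi): for [nonempty]
connected open `A ⊊ B ⊆ S¹`, (b) holds iff `B ≠ S¹`, i.e. iff (e).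
[cite: MochizukiFrdII2008, Lem 3.2 (vi) p.26] -/
theorem condB_iff_ne_univ {A B : Set Circle} (h : Setting A B) (hne : A ≠ B) :
    CondB A B ↔ B ≠ univ := by
  constructor
  · intro hB hBu
    subst hBu
    exact not_condB_univ hne hB
  · exact condB_of_ne_univ h

/-- Under the standing hypotheses, (b) is literally condition (e) "`B ≠ S¹`".
[cite: MochizukiFrdII2008, Lem 3.2 (vi) p.26] -/
theorem condB_iff_condE {A B : Set Circle} (h : Setting A B) (hne : A ≠ B) :
    CondB A B ↔ CondE A B :=
  condB_iff_ne_univ h hne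

/-- The universal closure of condition (b) is false. [cite: MochizukiFrdII2008, Lem 3.2 (vi)(b) p.26] -/
theorem not_forall_condB : ¬ ∀ A B : Set Circle, CondB A B :=
  fun h => not_condB_compl_singleton_univ 1 (h _ _)

/-- The universal closure of condition (b) is false even under the standing hypotheses of
Lemma 3.2 (vi) ([nonempty] connected open `A ⊊ B`). [cite: MochizukiFrdII2008, Lem 3.2 (vi)(b) p.26] -/
theorem not_forall_setting_condB : ¬ ∀ A B : Set Circle, Setting A B → A ≠ B → CondB A B := by
  intro h
  have hp : (1 : Circle) ∉ (({1}ᶜ : Set Circle)) := fun h1 => h1 rfl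
  have hS : IsSub ({1}ᶜ : Set Circle) univ {1}ᶜ := isSub_compl_singleton hp
  exact not_condB_compl_singleton_univ 1
    (h _ _ ⟨hS.1, hS.2.1, isConnected_univ, isOpen_univ, subset_univ _⟩
      (ne_univ_iff_exists_notMem _ |>.mpr ⟨1, hp⟩))

end CircleOpens

end Literature.AlgebraicGeometry.Frobenioids
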